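import Summits.NavierStokesRegularity.NavierStokesRegularity.Theorems.ExtremiserTransienceKStarAttainedContact
import HarnessLib

/-!
# Crux `ExtremiserTransience.NearExtremalTransience` (stmt-NavierStokesRegularity-21883), line `extremiser_liouville`,
# stub K1b `stub_noAnalyticExtremal` — STRATUM A: the square-integrable case is the tree's non-attainment theorem

`--supports stmt-NavierStokesRegularity-21883` (helper).  Author: prover seat `ns-el-k1b` (g0).

The registered stub K1b (`Cruxes/NearExtremalTransience/Lines/extremiser_liouville.lean`, v1.3) reads: there is NO
real-analytic field `w : ℝ³ → ℝ³` which is `C^∞`, divergence free, has bounded gradient, `D¹w, D²w ∈ L²`, and is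
non-trivially `κ⋆`-EFFICIENT for some bound `M ≥ ‖w‖`:
`κ⋆ · M · ‖curl w‖₂ · ‖∇ curl w‖₂ ≤ |∫⟪curl w, Dw curl w⟫|` with `M‖curl w‖₂‖∇curl w‖₂ > 0`, where `κ⋆ = sInf V` is the
sharp depletion constant of the tree (`V` = the universal constants of `|∫⟪ω, Dv ω⟫| ≤ κ M ‖ω‖₂ ‖∇ω‖₂` on the
ADMISSIBLE class: `C^∞`, divergence free, `‖v‖ ≤ M`, bounded gradient, `D⁰v, D¹v, D²v ∈ L²`).  The stub does NOT
assume `w ∈ L²`; that is its whole difficulty.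

This file settles the stratum `w ∈ L²` and records the reduction of the stub to its non-`L²` stratum:
* `noAnalyticExtremal_of_sqIntegrable` — **K1b for square-integrable fields.**  If moreover `D⁰w ∈ L²`, then `(w, M, B)`
  is admissible, so `κ⋆` being universal (`DepletionLadder.sharpDepletion_is_universal`) gives
  `|∫⟪ω, Dw ω⟫| ≤ κ⋆ M ‖ω‖₂ ‖∇ω‖₂`; with the stub's reverse inequality this is ATTAINMENT of `κ⋆`, which the tree
  excludes for real-analytic admissible fields (`DepletionLadder.KStar.not_attained_of_analyticOnNhd`: an attainer has
  a speed plateau with non-empty interior, impossible for analytic `‖w‖²` with `w → 0` at infinity).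
* `stub_noAnalyticExtremal_of_nonSqIntegrable` — **the registered stub, verbatim, follows from its non-`L²` stratum**
  (fields with `∫ ‖w‖² = ∞`: bounded fields converging to a non-zero constant at infinity, or decaying too slowly).
  That stratum is where «no gain from constants» (see the companion file
  `…ExtremiserLiouvilleNoGainFromConstants`) and the «plateau at infinity» case live; it is NOT proved here.

WHAT THIS IS NOT: not the stub K1b (its non-`L²` stratum stays open), nothing about the crux NET, nothing about
Navier–Stokes solutions; NS regularity is NOT proved by anything here. [folklore]
-/

noncomputable section

open Set MeasureTheory
open scoped InnerProductSpace RealInnerProductSpace ENNReal ContDiff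

namespace Summit.NavierStokesRegularity.NavierStokesRegularity.Theorems

-- the problem directory repeats the summit name (`NavierStokesRegularity/NavierStokesRegularity`)
set_option linter.dupNamespace false

namespace ExtremiserLiouville

/-- **K1b, stratum A (square-integrable fields): PROVED.**  No real-analytic ADMISSIBLE field (`C^∞`, divergence
free, bounded by `M`, bounded gradient, `D⁰w, D¹w, D²w ∈ L²`) is non-trivially `κ⋆`-efficient:
`κ⋆ M ‖ω‖₂ ‖∇ω‖₂ ≤ |∫⟪ω, Dw ω⟫|` with `M‖ω‖₂‖∇ω‖₂ > 0` is impossible.  (Universality of `κ⋆` gives `≤`, hence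
equality, and `KStar.not_attained_of_analyticOnNhd` excludes analytic attainers.)  The statement is the registered
stub with the single extra conjunct `∫⁻ ‖D⁰w‖² < ⊤`. [folklore] -/
theorem noAnalyticExtremal_of_sqIntegrable :
    ¬ ∃ (w : EuclideanSpace ℝ (Fin 3) → EuclideanSpace ℝ (Fin 3)), AnalyticOnNhd ℝ w Set.univ ∧ (∫⁻ x, ‖iteratedFDeriv ℝ 0 w x‖ₑ ^ 2 < ⊤) ∧ (ContDiff ℝ (⊤ : ℕ∞) w ∧ Literature.Analysis.FluidPDE.VectorCalculus.IsDivFree w ∧ (∃ B : ℝ, ∀ x, ‖fderiv ℝ w x‖ ≤ B) ∧ (∫⁻ x, ‖iteratedFDeriv ℝ 1 w x‖ₑ ^ 2 < ⊤) ∧ (∫⁻ x, ‖iteratedFDeriv ℝ 2 w x‖ₑ ^ 2 < ⊤) ∧ ∃ M : ℝ, (∀ x, ‖w x‖ ≤ M) ∧ 0 < M * Real.sqrt (∫ x, ‖Literature.Analysis.FluidPDE.curl w x‖ ^ 2) * Real.sqrt (∫ x, Literature.Analysis.FluidPDE.frobeniusNormSq (fderiv ℝ (Literature.Analysis.FluidPDE.curl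 w) x)) ∧ (sInf {κ : ℝ | (∀ (v : EuclideanSpace ℝ (Fin 3) → EuclideanSpace ℝ (Fin 3)) (M B : ℝ), ContDiff ℝ (⊤ : ℕ∞) v → Literature.Analysis.FluidPDE.VectorCalculus.IsDivFree v → (∀ x, ‖v x‖ ≤ M) → (∀ x, ‖fderiv ℝ v x‖ ≤ B) → (∫⁻ x, ‖iteratedFDeriv ℝ 0 v x‖ₑ ^ 2 < ⊤) → (∫⁻ x, ‖iteratedFDeriv ℝ 1 v x‖ₑ ^ 2 < ⊤) → (∫⁻ x, ‖iteratedFDeriv ℝ 2 v x‖ₑ ^ 2 < ⊤) → |∫ x, ⟪Literature.Analysis.FluidPDE.curl v x, fderiv ℝ v x (Literature.Analysis.FluidPDE.curl v x)⟫_ℝ| ≤ κ * M * Real.sqrt (∫ x, ‖Literature.Analysis.FluidPDE.curl v x‖ ^ 2) * Real.sqrt (∫ x, Literature.Analysis.FluidPDE.frobeniusNormSq (fderiv ℝ (Literature.Analysis.FluidPDE.curl v) x)))}) * M * Real.sqrt (∫ x, ‖Literature.Analysis.FluidPDE.curl w x‖ ^ 2) * Real.sqrt (∫ x, Literature.Analysis.FluidPDE.frobeniusNormSq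 (fderiv ℝ (Literature.Analysis.FluidPDE.curl w) x)) ≤ |∫ x, ⟪Literature.Analysis.FluidPDE.curl w x, fderiv ℝ w x (Literature.Analysis.FluidPDE.curl w x)⟫_ℝ|) := by
  rintro ⟨w, han, h0, hcd, hdiv, ⟨B, hB⟩, h1, h2, M, hM, hpos, hext⟩
  have hle := DepletionLadder.sharpDepletion_is_universal w M B hcd hdiv hM hB h0 h1 h2
  exact DepletionLadder.KStar.not_attained_of_analyticOnNhd hcd han hdiv hM hB h0 h1 h2 hpos (le_antisymm hle hext)

/-- **Reduction of the registered stub K1b to its non-`L²` stratum.**  If no real-analytic field of the stub's class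
with `∫ ‖w‖² = ∞` is non-trivially `κ⋆`-efficient, then the stub `stub_noAnalyticExtremal` holds VERBATIM (the
`L²` stratum being `noAnalyticExtremal_of_sqIntegrable`).  The hypothesis is NOT proved here. [folklore] -/
theorem stub_noAnalyticExtremal_of_nonSqIntegrable
    (h : ¬ ∃ (w : EuclideanSpace ℝ (Fin 3) → EuclideanSpace ℝ (Fin 3)), AnalyticOnNhd ℝ w Set.univ ∧ ¬ (∫⁻ x, ‖iteratedFDeriv ℝ 0 w x‖ₑ ^ 2 < ⊤) ∧ (ContDiff ℝ (⊤ : ℕ∞) w ∧ Literature.Analysis.FluidPDE.VectorCalculus.IsDivFree w ∧ (∃ B : ℝ, ∀ x, ‖fderiv ℝ w x‖ ≤ B) ∧ (∫⁻ x, ‖iteratedFDeriv ℝ 1 w x‖ₑ ^ 2 < ⊤) ∧ (∫⁻ x, ‖iteratedFDeriv ℝ 2 w x‖ₑ ^ 2 < ⊤) ∧ ∃ M : ℝ, (∀ x, ‖w x‖ ≤ M) ∧ 0 < M * Real.sqrt (∫ x, ‖Literature.Analysis.FluidPDE.curl w x‖ ^ 2) * Real.sqrt (∫ x, Literature.Analysis.FluidPDE.frobeniusNormSq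 (fderiv ℝ (Literature.Analysis.FluidPDE.curl w) x)) ∧ (sInf {κ : ℝ | (∀ (v : EuclideanSpace ℝ (Fin 3) → EuclideanSpace ℝ (Fin 3)) (M B : ℝ), ContDiff ℝ (⊤ : ℕ∞) v → Literature.Analysis.FluidPDE.VectorCalculus.IsDivFree v → (∀ x, ‖v x‖ ≤ M) → (∀ x, ‖fderiv ℝ v x‖ ≤ B) → (∫⁻ x, ‖iteratedFDeriv ℝ 0 v x‖ₑ ^ 2 < ⊤) → (∫⁻ x, ‖iteratedFDeriv ℝ 1 v x‖ₑ ^ 2 < ⊤) → (∫⁻ x, ‖iteratedFDeriv ℝ 2 v x‖ₑ ^ 2 < ⊤) → |∫ x, ⟪Literature.Analysis.FluidPDE.curl v x, fderiv ℝ v x (Literature.Analysis.FluidPDE.curl v x)⟫_ℝ| ≤ κ * M * Real.sqrt (∫ x, ‖Literature.Analysis.FluidPDE.curl v x‖ ^ 2) * Real.sqrt (∫ x, Literature.Analysis.FluidPDE.frobeniusNormSq (fderiv ℝ (Literature.Analysis.FluidPDE.curl v) x)))}) * M * Real.sqrt (∫ x, ‖Literature.Analysis.FluidPDE.curl w x‖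 ^ 2) * Real.sqrt (∫ x, Literature.Analysis.FluidPDE.frobeniusNormSq (fderiv ℝ (Literature.Analysis.FluidPDE.curl w) x)) ≤ |∫ x, ⟪Literature.Analysis.FluidPDE.curl w x, fderiv ℝ w x (Literature.Analysis.FluidPDE.curl w x)⟫_ℝ|)) :
    ¬ ∃ (w : EuclideanSpace ℝ (Fin 3) → EuclideanSpace ℝ (Fin 3)), AnalyticOnNhd ℝ w Set.univ ∧ (ContDiff ℝ (⊤ : ℕ∞) w ∧ Literature.Analysis.FluidPDE.VectorCalculus.IsDivFree w ∧ (∃ B : ℝ, ∀ x, ‖fderiv ℝ w x‖ ≤ B) ∧ (∫⁻ x, ‖iteratedFDeriv ℝ 1 w x‖ₑ ^ 2 < ⊤) ∧ (∫⁻ x, ‖iteratedFDeriv ℝ 2 w x‖ₑ ^ 2 < ⊤) ∧ ∃ M : ℝ, (∀ x, ‖w x‖ ≤ M) ∧ 0 < M * Real.sqrt (∫ x, ‖Literature.Analysis.FluidPDE.curl w x‖ ^ 2) * Real.sqrt (∫ x, Literature.Analysis.FluidPDE.frobeniusNormSq (fderiv ℝ (Literature.Analysis.FluidPDE.curl w)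 x)) ∧ (sInf {κ : ℝ | (∀ (v : EuclideanSpace ℝ (Fin 3) → EuclideanSpace ℝ (Fin 3)) (M B : ℝ), ContDiff ℝ (⊤ : ℕ∞) v → Literature.Analysis.FluidPDE.VectorCalculus.IsDivFree v → (∀ x, ‖v x‖ ≤ M) → (∀ x, ‖fderiv ℝ v x‖ ≤ B) → (∫⁻ x, ‖iteratedFDeriv ℝ 0 v x‖ₑ ^ 2 < ⊤) → (∫⁻ x, ‖iteratedFDeriv ℝ 1 v x‖ₑ ^ 2 < ⊤) → (∫⁻ x, ‖iteratedFDeriv ℝ 2 v x‖ₑ ^ 2 < ⊤) → |∫ x, ⟪Literature.Analysis.FluidPDE.curl v x, fderiv ℝ v x (Literature.Analysis.FluidPDE.curl v x)⟫_ℝ| ≤ κ * M * Real.sqrt (∫ x, ‖Literature.Analysis.FluidPDE.curl v x‖ ^ 2) * Real.sqrt (∫ x, Literature.Analysis.FluidPDE.frobeniusNormSq (fderiv ℝ (Literature.Analysis.FluidPDE.curl v) x)))}) * M * Real.sqrt (∫ x, ‖Literature.Analysis.FluidPDE.curl w x‖ ^ 2) * Real.sqrt (∫ x, Literature.Analysis.FluidPDE.frobeniusNormSq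 (fderiv ℝ (Literature.Analysis.FluidPDE.curl w) x)) ≤ |∫ x, ⟪Literature.Analysis.FluidPDE.curl w x, fderiv ℝ w x (Literature.Analysis.FluidPDE.curl w x)⟫_ℝ|) := by
  rintro ⟨w, han, hbody⟩
  by_cases h0 : (∫⁻ x, ‖iteratedFDeriv ℝ 0 w x‖ₑ ^ 2 < ⊤)
  · exact noAnalyticExtremal_of_sqIntegrable ⟨w, han, h0, hbody⟩
  · exact h ⟨w, han, h0, hbody⟩

end ExtremiserLiouville

end Summit.NavierStokesRegularity.NavierStokesRegularity.Theorems

end
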